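import Mathlib
import Summits.ValiantsHypothesis.ValiantsHypothesis.Theses.ValuativeGCT
import Summits.ValiantsHypothesis.ValiantsHypothesis.Theorems.TailFlip.Negative.TailFlipLoadBearing
import Summits.ValiantsHypothesis.ValiantsHypothesis.Theorems.ValuativeGCTValuativeFlipHeadSqrtTwo
import Summits.ValiantsHypothesis.ValiantsHypothesis.Theorems.ValuativeGCTValuativeFlipTailSuffices
import Summits.ValiantsHypothesis.ValiantsHypothesis.Theorems.ValuativeGCTValuativeFlipInnerMonotone
import Summits.ValiantsHypothesis.ValiantsHypothesis.Theorems.ValuativeGCTValuativeFlipPerAnchorInheritanceEvery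
import Summits.ValiantsHypothesis.ValiantsHypothesis.Theorems.ValuativeGCTValuativeFlipRayStabilityKronecker
import Summits.ValiantsHypothesis.ValiantsHypothesis.Theorems.ValuativeGCTValuativeFlipKroneckerCensus
import Summits.ValiantsHypothesis.ValiantsHypothesis.Theorems.ValuativeGCTValuativeFlipPaddedPerNoSmallBodyEquations
import HarnessLib

/-!
# Ladder-down from `ValuativeGCT.TailFlip` (stmt-ValiantsHypothesis-15687) — rung `SlopeTwoHead`,
# line `doubled-kronecker-deficit`

`TailFlip` (tribunal: summit-strength, `TailFlip ↔ ValuativeFlip ⟹ ValiantsHypothesis`) asks for a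
valuative multiplicity flip `FlipAt n m` at EVERY position of the quasi-polynomial window above every
slope `> 1`.  Ordered by the padding slope `θ = m/n`, what the tree proves is

* `θ ≤ 1`      : the bottom `m = n` (`valuativeFlip_cruxBody_bottom`, total-dimension count);
* `θ < √2`     : `headFlipBody_of_sq_lt_two` — for every rational `a/b` with `a² < 2b²`, eventually in
                 `n`, `FlipAt n m` for all `n ≤ m ≤ (a/b)·n` (four-row tangent-pencil count); and the
                 METHOD CEILING `fourRow_rankHyp_unsat`: the four-row count is unsatisfiable as soon as
                 `2n² + 2 ≤ m²`, i.e. from slope `√2` on (every bounded-row total count has the same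
                 ceiling: the determinant's `k`-row Hilbert function has exponent `(k-2)m² + 1` against the
                 padded permanent's `k·n² - 2n + k + 1`).

The RUNG filed here is the first level strictly above that ceiling:

  `SlopeTwoHead : ∃ n₀, ∀ n ≥ n₀, ∀ m, n ≤ m → m ≤ 2n → FlipAt n m`

(= the `c = 1` level of the crux given the landed head; `TailFlip → SlopeTwoHead` is
`slopeTwoHead_of_tailFlip`; `SlopeTwoHead` does NOT give `TailFlip` — the crux needs every window top
`2^((log₂ n + c)^c)`, cf. `not_tailFlipLen`, `statement_of_flipsAboveTops`).  By the landed inner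
monotonicity it is equivalent to flips on the STEEP EDGE `2n - 1 ≤ m ≤ 2n` (`slopeTwoHead_iff_steepEdge`).

## The line: doubled Kronecker deficit (isotypic, inherited, `U = ⊤` / no cut)

At `U = ⊤, r = m` the valuative factor of the truncation is `I^0 = ⊤` and
`dim T₀(λ, m) ≤ g(λ, m×δ, m×δ)` (BLMW Prop. 5.2.1, `stub_truncT0_le_kronecker`).  Take witnesses
INHERITED from the inner permanent: `λ = μ♯(n+j)` for an inner type `μ ⊢ nδ`, at level `m = n + j`,
`j ≤ n`.  Then (all landed)

  `dim T₀(μ♯(n+j), n+j) ≤ g(μ♯(n+j), (n+j)×δ, (n+j)×δ) ≤ g(μ♯(2n), 2n×δ, 2n×δ)`   (`kronecker_ray_mono`)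
  `P_n(μ) := mult_{μ*} ℂ[Δ_n(per_n)] ≤ mult_{μ♯*} ℂ[Δ_{n+j}(X₀₀^j per_n)]`        (`perAnchorInheritance_every`)

so a flip at EVERY level of `[n, 2n]` follows from ONE inequality at the inner level:
`g(μ♯(2n), 2n×δ, 2n×δ) < P_n(μ)` — "the inner permanent beats the DOUBLED Kronecker coefficient".
Writing `P_n(μ) = a_μ(δ[n]) - E_n(μ)` (plethysm coefficient minus the permanent's equation count at `μ`)
splits it into the two registered stubs:

* `stub_doubledDeficitTypes` (algebraic combinatorics, NO orbit closures; provable by a dimension count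
  for `n ≥ 4`: `dim Sym^δ Sym^n ℂ^{n²} ~ δ^{C(n²+n-1,n)-1}` dwarfs the `(2n×δ, 2n×δ)`-highest-weight count
  `≲ δ^{4n⁴-4n+1}` of `Sym^{2nδ}(ℂ^{n²} ⊗ ℂ^{2n} ⊗ ℂ^{2n})`): eventually in `n` and in `δ` some type
  `μ ⊢ nδ` has `g(μ♯(2n), 2n×δ, 2n×δ) < a_μ(δ[n])` — the UNSTABLE-range converse of
  Ikenmeyer–Panova 2017 Prop. 15 (`g ≥ a` in the stable range `|μ̄| ≤ level`); such `μ` have body `> 2n`.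
* `stub_perFreeOnDeficitTypes` (the per-isotypic core, about `per_n` ALONE relative to a computable
  class): at every degree where doubled-deficit types exist, the permanent is EQUATION-FREE
  (`P_n(μ) = a_μ(δ[n])`, cf. the landed `paddedPer_orbitMultiplicity_eq_plethysmCoeff_of_bodySize_le_inner`
  for bodies `≤ n`) on at least one of them.

`SlopeTwoHead_of` is the kernel-checked composition.  Cheapest falsifier: at `(n, 2n) = (3, 6)`,
`δ = 4, 5`: list `μ ⊢ 3δ` (`≤ 9` parts) with `g(μ♯(6), 6×δ, 6×δ) < a_μ(δ[3])` (symmetric-group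
characters of `S_{24}`, `S_{30}`) and evaluate the `a_μ` highest-weight vectors at random points of
`GL_9 · per_3`.
-/

namespace Summit.ValiantsHypothesis.ValiantsHypothesis.Cruxes.TailFlip.SlopeTwoHead

open Literature.NumberTheory.DiophantineGeometry Literature.Computability.AlgebraicComplexity
open Literature.Computability.Complexity
open Summit.ValiantsHypothesis.ValiantsHypothesis.Theses.ValuativeGCT
open Summit.ValiantsHypothesis.ValiantsHypothesis.Theorems.TailFlip.Negative
open Summit.ValiantsHypothesis.ValiantsHypothesis.Theorems.ValuativeFlip

/-! ## The ladder family and the rung -/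

/-- **Ladder family** (parameter: the padding slope `a/b`): eventually in `n`, a valuative flip at
every position `n ≤ m ≤ (a/b)·n`.  `FlipAt n m` is the crux body VERBATIM
(`TailFlip.Negative.FlipAt`, `tailFlip_iff : TailFlip ↔ … FlipAt n m := Iff.rfl`). -/
def SlopeHead (a b : ℕ) : Prop :=
  ∃ n₀ : ℕ, ∀ n ≥ n₀, ∀ (m : ℕ) [NeZero m], n ≤ m → b * m ≤ a * n → FlipAt n m

/-- **THE RUNG** `SlopeTwoHead = SlopeHead 2 1`: eventually in `n`, `FlipAt n m` for every
`n ≤ m ≤ 2n` — the linear window up to the doubling level, the first level above the `√2`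
ceiling of every bounded-row count (`fourRow_rankHyp_unsat`). -/
def SlopeTwoHead : Prop :=
  SlopeHead 2 1

/-- **FLOOR (F3 witness family)**: every slope below `√2` is landed
(`headFlipBody_of_sq_lt_two`, four-row tangent pencil). [tree] -/
theorem slopeHead_of_sq_lt_two (a b : ℕ) (hb : 0 < b) (hab : a ^ 2 < 2 * b ^ 2) : SlopeHead a b :=
  headFlipBody_of_sq_lt_two a b hb hab

/-- **FLOOR, named instance**: slope `7/5` (`49 < 50`). [tree: `headFlipBody_seven_fifths`] -/
theorem slopeHead_seven_fifths : SlopeHead 7 5 :=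
  slopeHead_of_sq_lt_two 7 5 (by norm_num) (by norm_num)

/-- The ladder is monotone in the slope: `a/b ≤ a'/b'` and `SlopeHead a' b'` give `SlopeHead a b`. -/
theorem slopeHead_anti {a b a' b' : ℕ} (hb : 0 < b) (h : a * b' ≤ a' * b) :
    SlopeHead a' b' → SlopeHead a b := by
  rintro ⟨n₀, hn₀⟩
  refine ⟨n₀, fun n hn m _ hnm hbm => hn₀ n hn m hnm ?_⟩
  have key : b * (b' * m) ≤ b * (a' * n) :=
    calc b * (b' * m) = b' * (b * m) := by ring
      _ ≤ b' * (a * n) := Nat.mul_le_mul_left _ hbm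
      _ = (a * b') * n := by ring
      _ ≤ (a' * b) * n := Nat.mul_le_mul_right _ h
      _ = b * (a' * n) := by ring
  exact Nat.le_of_mul_le_mul_left key hb

/-- **ON-PATH**: the crux implies the rung (`TailFlip → ValuativeFlip`, then the window with
exponent `2`: `m ≤ 2n < 2^(log₂ n + 2) ≤ 2^((log₂ n + 2)^2)`). [tree: `valuativeFlip_of_tailFlip`] -/
theorem slopeTwoHead_of_tailFlip (hT : TailFlip) : SlopeTwoHead := by
  obtain ⟨n₀, hn₀⟩ := valuativeFlip_of_tailFlip hT 2
  refine ⟨n₀, fun n hn m _ hnm hmn => hn₀ n hn m hnm ?_⟩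
  have h1 : n < 2 ^ (Nat.log 2 n + 1) := Nat.lt_pow_succ_log_self (by norm_num) n
  have h2 : m ≤ 2 ^ (Nat.log 2 n + 2) := by
    rw [pow_succ]
    omega
  exact h2.trans (Nat.pow_le_pow_right (by norm_num) (by nlinarith))

/-- **STEEP-EDGE NORMAL FORM**: the rung is equivalent to flips on the edge `2n - 1 ≤ m ≤ 2n` only
(a flip at `(⌈m/2⌉, m)` propagates to every `(n, m)` with `⌈m/2⌉ ≤ n ≤ m`, because
`X₀₀^{m-⌈m/2⌉} per_{⌈m/2⌉}` is a degeneration of `X₀₀^{m-n} per_n` and the determinant side does not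
see `n` — `flipBody_mono_inner`). [tree: `flipBody_mono_inner`] -/
theorem slopeTwoHead_iff_steepEdge :
    SlopeTwoHead ↔
      ∃ n₀ : ℕ, ∀ n ≥ n₀, ∀ (m : ℕ) [NeZero m], 2 * n - 1 ≤ m → m ≤ 2 * n → FlipAt n m := by
  constructor
  · rintro ⟨n₀, hn₀⟩
    exact ⟨n₀, fun n hn m _ h1 h2 => hn₀ n hn m (by omega) (by omega)⟩
  · rintro ⟨n₀, hn₀⟩
    refine ⟨2 * n₀ + 1, fun n hn m _ hnm hmn => ?_⟩
    have key := hn₀ ((m + 1) / 2) (by omega) m (by omega) (by omega)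
    exact flipBody_mono_inner (show (m + 1) / 2 ≤ n by omega) hnm key

/-! ## The line `doubled-kronecker-deficit` -/

/-- A **doubled-deficit type** at inner level `n`, degree `δ`: a shape `μ ⊢ nδ` with at most `n²`
parts whose `n`-fold row lift has rectangular Kronecker coefficient at the DOUBLED level `2n`
strictly below the plethysm coefficient of `μ` at level `n`:
`g(μ♯(2n), 2n×δ, 2n×δ) < a_μ(δ[n])`.  Pure algebraic combinatorics (no orbit closures). -/
def DoubledDeficit (n δ : ℕ) (μ : Nat.Partition (n * δ)) : Prop :=
  μ.parts.card ≤ n * n ∧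
    kroneckerCoeff ℂ (rowLift μ n) (Nat.Partition.rectangle (n + n) δ) (Nat.Partition.rectangle (n + n) δ) <
      plethysmCoeff ℂ (MatIdx n) n (partitionWeightLex n μ)

/-- The permanent is **equation-free at `μ`**: `mult_{μ*} ℂ[Δ_n(per_n)] = a_μ(δ[n])` (no highest-weight
vector of type `μ` in `ℂ[Sym^n]_δ` vanishes on `GL_{n²} · per_n`; `per_n = paddedPerFormLex ℂ n n`). -/
def PerEquationFree (n δ : ℕ) [NeZero n] (μ : Nat.Partition (n * δ)) : Prop :=
  orbitMultiplicity ℂ (paddedPerFormLex ℂ n n) n (partitionWeightLex n μ) =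
    plethysmCoeff ℂ (MatIdx n) n (partitionWeightLex n μ)

/-- **STUB 1 — doubled-deficit types exist** (eventually in `n`, eventually in `δ`).  Why plausibly
true: for `n ≥ 4` a dimension count — `dim Sym^δ Sym^n ℂ^{n²} = Σ_μ a_μ(δ[n])·dim V_μ(ℂ^{n²})` has degree
`C(n²+n-1, n) - 1` in `δ` while `Σ_μ g(μ♯(2n), 2n×δ, 2n×δ)·dim V_μ(ℂ^{n²})` is at most the number of
torus-weight-`(δ^{2n}, δ^{2n})` monomials of `Sym^{2nδ}(ℂ^{n²} ⊗ ℂ^{2n} ⊗ ℂ^{2n})`, degree `≤ 4n⁴ - 4n + 1`.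
Size: L (GL-decomposition of `Sym^δ Sym^n`, Schur–Weyl for `g`).  The unstable-range converse of
Ikenmeyer–Panova 2017 Prop. 15. [Ikenmeyer–Panova arXiv:1512.03798 Prop. 15, Ex. (13,13,2⁵); this line] -/
theorem stub_doubledDeficitTypes :
    ∃ n₀ : ℕ, ∀ n ≥ n₀, ∃ δ₀ : ℕ, ∀ δ ≥ δ₀, ∃ μ : Nat.Partition (n * δ), DoubledDeficit n δ μ := by
  sorry

/-- **STUB 2 — the permanent is equation-free on some doubled-deficit type** (the per-isotypic core,
HARDEST): eventually in `n` and `δ`, whenever doubled-deficit types exist at `(n, δ)`, `per_n` is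
equation-free at one of them.  Why it might fail: doubled-deficit types have body `> 2n`, beyond the
landed equation-free range `|μ̄| ≤ n` (`paddedPer_orbitMultiplicity_eq_plethysmCoeff_of_bodySize_le_inner`),
and by mass most of them carry equations of `per_n`; the bet is on the small-`a_μ` deficit types
(Kronecker zeros / near-zeros at level `2n` on lifted per-occurring shapes — excluded by
Ikenmeyer–Panova only for det size `> 3n⁴`, by BIP only for `≥ n^25`).  Size: XL. [this line] -/
theorem stub_perFreeOnDeficitTypes :
    ∃ n₀ : ℕ, ∀ (n : ℕ) [NeZero n], n₀ ≤ n → ∃ δ₀ : ℕ, ∀ δ ≥ δ₀,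
      (∃ μ : Nat.Partition (n * δ), DoubledDeficit n δ μ) →
        ∃ μ : Nat.Partition (n * δ), DoubledDeficit n δ μ ∧ PerEquationFree n δ μ := by
  sorry

/-- **COMPOSITION (kernel-checked)**: the two stubs give the rung.  At level `m = n + j`, `j ≤ n`,
witness `(U, r, δ, λ) = (⊤, m, δ, μ♯(m))`:
`dim T = dim T₀ ≤ g(μ♯(m), m×δ, m×δ) ≤ g(μ♯(2n), 2n×δ, 2n×δ) < a_μ(δ[n]) = P_n(μ) ≤ mult_pp(μ♯(m)*)`. -/
theorem SlopeTwoHead_of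
    (h₁ : ∃ n₀ : ℕ, ∀ n ≥ n₀, ∃ δ₀ : ℕ, ∀ δ ≥ δ₀, ∃ μ : Nat.Partition (n * δ), DoubledDeficit n δ μ)
    (h₂ : ∃ n₀ : ℕ, ∀ (n : ℕ) [NeZero n], n₀ ≤ n → ∃ δ₀ : ℕ, ∀ δ ≥ δ₀,
      (∃ μ : Nat.Partition (n * δ), DoubledDeficit n δ μ) →
        ∃ μ : Nat.Partition (n * δ), DoubledDeficit n δ μ ∧ PerEquationFree n δ μ) :
    SlopeTwoHead := by
  obtain ⟨n₁, hn₁⟩ := h₁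
  obtain ⟨n₂, hn₂⟩ := h₂
  refine ⟨max (max n₁ n₂) 1, fun n hn m _ hnm hmn => ?_⟩
  haveI : NeZero n := ⟨by omega⟩
  obtain ⟨δ₁, hδ₁⟩ := hn₁ n (by omega)
  obtain ⟨δ₂, hδ₂⟩ := hn₂ n (by omega)
  obtain ⟨δ, hδ1, hδ2⟩ : ∃ δ, δ₁ ≤ δ ∧ δ₂ ≤ δ := ⟨max δ₁ δ₂, le_max_left _ _, le_max_right _ _⟩
  obtain ⟨μ, ⟨hcard, hdef⟩, hfree⟩ := hδ₂ δ hδ2 (hδ₁ δ hδ1)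
  obtain ⟨j, rfl⟩ : ∃ j, m = n + j := ⟨m - n, by omega⟩
  have hj : j ≤ n := by omega
  have hcard' : (rowLift μ j).parts.card ≤ (n + j) * (n + j) := card_parts_rowLift_le_sq μ hcard j
  have hlt : kroneckerCoeff ℂ (rowLift μ j) (Nat.Partition.rectangle (n + j) δ)
        (Nat.Partition.rectangle (n + j) δ) <
      orbitMultiplicity ℂ (paddedPerFormLex ℂ n (n + j)) (n + j)
        (partitionWeightLex (n + j) (rowLift μ j)) :=
    calc kroneckerCoeff ℂ (rowLift μ j) (Nat.Partition.rectangle (n + j) δ)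
          (Nat.Partition.rectangle (n + j) δ)
        ≤ kroneckerCoeff ℂ (rowLift μ n) (Nat.Partition.rectangle (n + n) δ)
            (Nat.Partition.rectangle (n + n) δ) := kronecker_ray_mono n δ μ hj
      _ < plethysmCoeff ℂ (MatIdx n) n (partitionWeightLex n μ) := hdef
      _ = orbitMultiplicity ℂ (paddedPerFormLex ℂ n n) n (partitionWeightLex n μ) := hfree.symm
      _ ≤ _ := perAnchorInheritance_every n j δ μ hcard
  unfold FlipAt
  refine ⟨⊤, n + j, δ, rowLift μ j, fun u _ => Matrix.rank_le_width _, hcard', ?_⟩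
  dsimp only
  refine lt_of_le_of_lt (le_of_eq_of_le ?_ (stub_truncT0_le_kronecker (n + j) δ (rowLift μ j) hcard')) hlt
  refine congrArg
    (fun S : Submodule ℂ (MvPolynomial (MatIdx (n + j) × MatIdx (n + j)) ℂ) => Module.finrank ℂ ↥S) ?_
  rw [Nat.sub_self, mul_zero, pow_zero, Ideal.one_eq_top, Submodule.restrictScalars_top, inf_top_eq]

/-- The same composition with the registered stubs plugged in (sorries live only in `stub_*`). -/
theorem slopeTwoHead_of_stubs : SlopeTwoHead :=
  SlopeTwoHead_of stub_doubledDeficitTypes stub_perFreeOnDeficitTypes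

/-! ## The ladder above the rung (typed, not registered): polynomial and quasi-polynomial windows -/

/-- Rung family II (parameter: polynomial exponent `k`): eventually in `n`, flips at every
`n ≤ m ≤ n^k`.  `PolyHead 1` is the bottom; `SlopeTwoHead → PolyHead 1`; no finite `k` gives `TailFlip`. -/
def PolyHead (k : ℕ) : Prop :=
  ∃ n₀ : ℕ, ∀ n ≥ n₀, ∀ (m : ℕ) [NeZero m], n ≤ m → m ≤ n ^ k → FlipAt n m

/-- Rung family III (parameter: the window exponent `c` of the crux itself): the tail at ONE `c`.
The crux is the limit `∀ c` (`tailFlip_iff_forall_quasiPolyTail`); the passage to the limit — uniformity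
in `c` — is the summit-strength step and is NOT filed. -/
def QuasiPolyTail (c : ℕ) : Prop :=
  ∀ a b : ℕ, b < a → ∃ n₀ : ℕ, ∀ n ≥ n₀, ∀ (m : ℕ) [NeZero m],
    a * n < b * m → m ≤ 2 ^ ((Nat.log 2 n + c) ^ c) → FlipAt n m

/-- The ladder top in its own gradation: `TailFlip ↔ ∀ c, QuasiPolyTail c`. -/
theorem tailFlip_iff_forall_quasiPolyTail : TailFlip ↔ ∀ c, QuasiPolyTail c :=
  ⟨fun h c a b hab => h a b hab c, fun h a b hab c => h c a b hab⟩

/-- Down the ladder: the slope-2 rung gives the polynomial rung `k = 1` (window `n ≤ m ≤ n`). -/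
theorem polyHead_one_of_slopeTwoHead (h : SlopeTwoHead) : PolyHead 1 := by
  obtain ⟨n₀, hn₀⟩ := h
  refine ⟨n₀, fun n hn m _ hnm hmn => hn₀ n hn m hnm ?_⟩
  rw [pow_one] at hmn
  omega

/-! ## The same lever at every window level: the crux-concluding skeleton

The deficit condition is MONOTONE in the level (`kronecker_ray_mono`: `g(μ♯(n+j), …)` is non-decreasing
in `j`), and `PerEquationFree` does not mention the level at all.  So the ladder, read in the line's own
language, is graded by the LEVEL at which the Kronecker deficit is demanded: level `2n` (the rung) ⊇ level
`n^k` ⊇ level `2^((log₂ n + c)^c)` (the crux at window exponent `c`).  The dimension count behind stub 1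
works at every quasi-polynomial level (`n²·m² - 2m + 1` is polynomial / quasi-polynomial in `n`, while
`C(n²+n-1, n) - 1` is super-polynomial), and `TailFlip` quantifies `c` OUTSIDE `n₀`, so NO passage to the
limit is needed: the crux follows from the two window-level stubs below, level by level.  They are
registered so that the skeleton concludes the crux BY NAME (`forall_quasiPolyTail_of`, `TailFlip_proof`); the rung's
stubs above are their level-`2n` shadows (`doubledDeficit_of_windowDeficit`). -/

/-- A **window-deficit type** at exponent `c`: as `DoubledDeficit`, with the Kronecker coefficient taken at
the window top `W = 2^((log₂ n + c)^c)` (level `n + (W - n)`). -/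
def WindowDeficit (c n δ : ℕ) (μ : Nat.Partition (n * δ)) : Prop :=
  μ.parts.card ≤ n * n ∧
    kroneckerCoeff ℂ (rowLift μ (2 ^ ((Nat.log 2 n + c) ^ c) - n))
        (Nat.Partition.rectangle (n + (2 ^ ((Nat.log 2 n + c) ^ c) - n)) δ)
        (Nat.Partition.rectangle (n + (2 ^ ((Nat.log 2 n + c) ^ c) - n)) δ) <
      plethysmCoeff ℂ (MatIdx n) n (partitionWeightLex n μ)

/-- Nesting of the ladder: a window-deficit type (window top `≥ 2n`) is a doubled-deficit type. -/
theorem doubledDeficit_of_windowDeficit {c n δ : ℕ} {μ : Nat.Partition (n * δ)}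
    (hW : n ≤ 2 ^ ((Nat.log 2 n + c) ^ c) - n) (h : WindowDeficit c n δ μ) : DoubledDeficit n δ μ :=
  ⟨h.1, (kronecker_ray_mono n δ μ hW).trans_lt h.2⟩

/-- **STUB 3 — window-deficit types exist** (every `c`; eventually in `n`, eventually in `δ`).  Same
dimension count as stub 1: at level `m = 2^((log₂ n + c)^c)` the `(m×δ, m×δ)`-highest-weight count has
degree `≤ n²m² - 2m + 1 = 2^{O((log n + c)^c)}` in `δ`... as an exponent it is quasi-polynomial in `n`, still
below `C(n²+n-1, n) - 1 ≥ (n+1)^{n-1}`-type growth for `n ≥ n₀(c)`.  Size L. [this line; IP17 Prop 15 converse] -/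
theorem stub_windowDeficitTypes :
    ∀ c : ℕ, ∃ n₀ : ℕ, ∀ n ≥ n₀, ∃ δ₀ : ℕ, ∀ δ ≥ δ₀,
      ∃ μ : Nat.Partition (n * δ), WindowDeficit c n δ μ := by
  sorry

/-- **STUB 4 — the permanent is equation-free on some window-deficit type** (every `c`; the crux-level
core; contains STUB 2 as its level-`2n` shadow).  Why it might fail: as stub 2, sharper — the deficit class
shrinks as the level grows (only types with `g(μ♯(m), m×δ, m×δ) < a_μ(δ[n])` at quasi-polynomial `m`
remain; by the count they still carry almost all plethysm mass, but the per-generic ones among them are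
not located).  Size XL. [this line] -/
theorem stub_perFreeOnWindowDeficitTypes :
    ∀ c : ℕ, ∃ n₀ : ℕ, ∀ (n : ℕ) [NeZero n], n₀ ≤ n → ∃ δ₀ : ℕ, ∀ δ ≥ δ₀,
      (∃ μ : Nat.Partition (n * δ), WindowDeficit c n δ μ) →
        ∃ μ : Nat.Partition (n * δ), WindowDeficit c n δ μ ∧ PerEquationFree n δ μ := by
  sorry

/-- **CRUX COMPOSITION, level by level (kernel-checked)**: the two window-level stubs give every rung
`QuasiPolyTail c` of the crux's own gradation, hence `TailFlip` itself (`TailFlip_proof`; no limit step).  Witness at `(n, m = n + j)`, `j ≤ W - n`: `(⊤, m, δ, μ♯(m))`, chain as in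
`SlopeTwoHead_of` with `kronecker_ray_mono n δ μ (hj : j ≤ W - n)`. -/
theorem forall_quasiPolyTail_of
    (hA : ∀ c : ℕ, ∃ n₀ : ℕ, ∀ n ≥ n₀, ∃ δ₀ : ℕ, ∀ δ ≥ δ₀,
      ∃ μ : Nat.Partition (n * δ), WindowDeficit c n δ μ)
    (hB : ∀ c : ℕ, ∃ n₀ : ℕ, ∀ (n : ℕ) [NeZero n], n₀ ≤ n → ∃ δ₀ : ℕ, ∀ δ ≥ δ₀,
      (∃ μ : Nat.Partition (n * δ), WindowDeficit c n δ μ) →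
        ∃ μ : Nat.Partition (n * δ), WindowDeficit c n δ μ ∧ PerEquationFree n δ μ) :
    ∀ c, QuasiPolyTail c := by
  intro c a b hab
  obtain ⟨n₁, hn₁⟩ := hA c
  obtain ⟨n₂, hn₂⟩ := hB c
  refine ⟨max (max n₁ n₂) 1, fun n hn m _ hlt hle => ?_⟩
  haveI : NeZero n := ⟨by omega⟩
  obtain ⟨δ₁, hδ₁⟩ := hn₁ n (by omega)
  obtain ⟨δ₂, hδ₂⟩ := hn₂ n (by omega)
  obtain ⟨δ, hδ1, hδ2⟩ : ∃ δ, δ₁ ≤ δ ∧ δ₂ ≤ δ := ⟨max δ₁ δ₂, le_max_left _ _, le_max_right _ _⟩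
  obtain ⟨μ, ⟨hcard, hdef⟩, hfree⟩ := hδ₂ δ hδ2 (hδ₁ δ hδ1)
  have hnm : n < m := by
    by_contra hmn
    push Not at hmn
    have := Nat.mul_le_mul (le_of_lt hab) hmn
    omega
  obtain ⟨j, rfl⟩ : ∃ j, m = n + j := ⟨m - n, by omega⟩
  have hj : j ≤ 2 ^ ((Nat.log 2 n + c) ^ c) - n := by omega
  have hcard' : (rowLift μ j).parts.card ≤ (n + j) * (n + j) := card_parts_rowLift_le_sq μ hcard j
  have hlt' : kroneckerCoeff ℂ (rowLift μ j) (Nat.Partition.rectangle (n + j) δ)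
        (Nat.Partition.rectangle (n + j) δ) <
      orbitMultiplicity ℂ (paddedPerFormLex ℂ n (n + j)) (n + j)
        (partitionWeightLex (n + j) (rowLift μ j)) :=
    calc kroneckerCoeff ℂ (rowLift μ j) (Nat.Partition.rectangle (n + j) δ)
          (Nat.Partition.rectangle (n + j) δ)
        ≤ kroneckerCoeff ℂ (rowLift μ (2 ^ ((Nat.log 2 n + c) ^ c) - n))
            (Nat.Partition.rectangle (n + (2 ^ ((Nat.log 2 n + c) ^ c) - n)) δ)
            (Nat.Partition.rectangle (n + (2 ^ ((Nat.log 2 n + c) ^ c) - n)) δ) :=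
          kronecker_ray_mono n δ μ hj
      _ < plethysmCoeff ℂ (MatIdx n) n (partitionWeightLex n μ) := hdef
      _ = orbitMultiplicity ℂ (paddedPerFormLex ℂ n n) n (partitionWeightLex n μ) := hfree.symm
      _ ≤ _ := perAnchorInheritance_every n j δ μ hcard
  refine ⟨⊤, n + j, δ, rowLift μ j, fun u _ => Matrix.rank_le_width _, hcard', ?_⟩
  dsimp only
  refine lt_of_le_of_lt
    (le_of_eq_of_le ?_ (stub_truncT0_le_kronecker (n + j) δ (rowLift μ j) hcard')) hlt'
  refine congrArg
    (fun S : Submodule ℂ (MvPolynomial (MatIdx (n + j) × MatIdx (n + j)) ℂ) => Module.finrank ℂ ↥S) ?_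
  rw [Nat.sub_self, mul_zero, pow_zero, Ideal.one_eq_top, Submodule.restrictScalars_top, inf_top_eq]

/-- The crux BY NAME from the registered stubs (sorries live only in `stub_*`). -/
theorem TailFlip_proof : TailFlip :=
  tailFlip_iff_forall_quasiPolyTail.2
    (forall_quasiPolyTail_of stub_windowDeficitTypes stub_perFreeOnWindowDeficitTypes)

/-- Down the ladder inside the line: the window-level stubs also give the rung (through the crux and
the proved on-path implication). -/
theorem slopeTwoHead_of_windowStubs
    (hA : ∀ c : ℕ, ∃ n₀ : ℕ, ∀ n ≥ n₀, ∃ δ₀ : ℕ, ∀ δ ≥ δ₀,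
      ∃ μ : Nat.Partition (n * δ), WindowDeficit c n δ μ)
    (hB : ∀ c : ℕ, ∃ n₀ : ℕ, ∀ (n : ℕ) [NeZero n], n₀ ≤ n → ∃ δ₀ : ℕ, ∀ δ ≥ δ₀,
      (∃ μ : Nat.Partition (n * δ), WindowDeficit c n δ μ) →
        ∃ μ : Nat.Partition (n * δ), WindowDeficit c n δ μ ∧ PerEquationFree n δ μ) :
    SlopeTwoHead :=
  slopeTwoHead_of_tailFlip (tailFlip_iff_forall_quasiPolyTail.2 (forall_quasiPolyTail_of hA hB))

end Summit.ValiantsHypothesis.ValiantsHypothesis.Cruxes.TailFlip.SlopeTwoHead
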